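import Mathlib
import HarnessLib
import HarnessLib.Audit
import Summits.SmoothPoincare4.Statement
import Literature.Geometry.Riemannian.RiemannianDistance
import HarnessLib.Audit.Status.Attr

/-!
Route: CutLocusSpine

DORMANT since 2026-08-22T10:35:41Z (reconciler: no traction for 5.3 d (last activity item-evidence-added at 2026-08-17T03:14:47Z); parked, not closed — `ledger route dormant route-SmoothPoincare4-CutLocusSpine --off` to reactivate) — unstaffed, not closed; items shared with open routes are served there. `ledger route dormant <id> --off` reactivates.

# Route CutLocusSpine — Comb the cut locus — SPC4 as the vanishing of the minimal-geodesic
multiplicity ladder of Riemannian homotopy 4-spheres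

It suffices to show X = MultiplicityFour ∧ RungFour (card cut-locus-spines-maxwell, rendered through
its complexity
ladder). Present a homotopy 4-sphere Σ by the CUT LOCUS Cut_g(p) of a Riemannian metric: Σ ∖
Cut_g(p) = exp_p(open cut
domain) is an open 4-ball and Σ ∖ {p} retracts radially onto Cut_g(p), so Cut_g(p) is a canonical,
generically stratified
spine of the homotopy 4-ball Σ ∖ B(p,ε). Everything is stated METRICALLY over the tree's Riemannian
distance d = `g.edist hg`
(no exponential map needed): Cut_g(p) = {q ≠ p | no r ≠ q with d(p,r) = d(p,q) + d(q,r)} (points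
beyond which no minimal
segment from p extends), and the MULTIPLICITY N(q) = number of minimal geodesics from p to q =
number of midpoints, i.e.
the cardinality of {m | d(p,m) = d(m,q), d(p,m)+d(m,q) = d(p,q)} (the Maxwell order of q;
Buchner-generic cut loci in dimension 4 have N ≤ 5
with isolated quintuple points A₁⁵ — the card's complexity c_cut counts them). MultiplicityFour
(∃-half): every homotopy
4-sphere carries a smooth metric g and a point p whose cut locus is triangulable (homeomorphic to a
finite simplicial complex —
Buchner: automatic for real-analytic g) and has N ≤ 4 everywhere (c_cut(Σ) = 0). RungFour
(recognition half): a homotopy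
4-sphere carrying such a (g,p) is diffeomorphic to S⁴. Both halves follow from SPC4 (the 4-ellipsoid
has a 3-disc cut locus
with N ≤ 2, ItohKiyohara2010 Thm 7.1), so X ⇔ SPC4; the content is the ladder RungTwo ⇐ RungThree ⇐
RungFour of
unconditional recognition theorems graded by multiplicity, whose bottom rung is attackable now.
Lean: `(∀ (M : Type) [TopologicalSpace M] [T2Space M] [SecondCountableTopology M] [ChartedSpace
(EuclideanSpace ℝ (Fin 4)) M] [IsManifold (𝓡 4) ∞ M], ContinuousMap.HomotopyEquiv M (Metric.sphere
(0 : EuclideanSpace ℝ (Fin 5)) 1) → ∃ (g : Literature.Geometry.Lorentzian.PseudoRiemannianMetric (𝓡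
4) ∞ (EuclideanSpace ℝ (Fin 4)) (TangentSpace (𝓡 4) : M → Type _)) (hg : g.IsRiemannian) (p : M), (∃
(k : ℕ) (K : Geometry.SimplicialComplex ℝ (EuclideanSpace ℝ (Fin k))) (φ : K.space → M),
K.faces.Finite ∧ Topology.IsEmbedding φ ∧ Set.range φ = {q : M | q ≠ p ∧ ∀ r : M, g.edist hg p r =
g.edist hg p q + g.edist hg q r → r = q}) ∧ ∀ q : M, ({m : M | g.edist hg p m = g.edist hg m q ∧
g.edist hg p m + g.edist hg m q = g.edist hg p q}).encard ≤ 4) ∧ (∀ (M : Type) [TopologicalSpace M]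
[T2Space M] [SecondCountableTopology M] [ChartedSpace (EuclideanSpace ℝ (Fin 4)) M] [IsManifold (𝓡
4) ∞ M], ContinuousMap.HomotopyEquiv M (Metric.sphere (0 : EuclideanSpace ℝ (Fin 5)) 1) → ∀ (g :
Literature.Geometry.Lorentzian.PseudoRiemannianMetric (𝓡 4) ∞ (EuclideanSpace ℝ (Fin 4))
(TangentSpace (𝓡 4) : M → Type _)) (hg : g.IsRiemannian) (p : M), (∃ (k : ℕ) (K :
Geometry.SimplicialComplex ℝ (EuclideanSpace ℝ (Fin k))) (φ : K.space → M), K.faces.Finite ∧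
Topology.IsEmbedding φ ∧ Set.range φ = {q : M | q ≠ p ∧ ∀ r : M, g.edist hg p r = g.edist hg p q +
g.edist hg q r → r = q}) → (∀ q : M, ({m : M | g.edist hg p m = g.edist hg m q ∧ g.edist hg p m +
g.edist hg m q = g.edist hg p q}).encard ≤ 4) → Nonempty (M ≃ₘ⟮𝓡 4, 𝓡 4⟯ Metric.sphere (0 :
EuclideanSpace ℝ (Fin 5)) 1))`

## Assembly
Pure logic, three lines: given the Statement's own binders (M, e : M ≃ₕ S⁴), MultiplicityFour hands
back a triangulable
multiplicity-≤-4 pair (g,p) on M and RungFour returns the diffeomorphism M ≅ S⁴ — `theorem closes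
(hM : MultiplicityFour)
(hR : RungFour) : SmoothPoincare4` (certified, axioms propext / Classical.choice / Quot.sound). Rev
2 (cone repair): every item is
stated over the bare pair (M, e) instead of the bundled `HomotopySphere 4`; compactness and
orientability of M are PROVED theorems
in tree (`compactSpace_of_homotopyEquiv_sphere_four_holds`,
`isOrientable_of_homotopyEquiv_sphere_four_holds`) that provers may
invoke, not hypotheses, so the route file imports only
`Literature.Geometry.Riemannian.RiemannianDistance` and no h-cobordism /
Θₙ / connected-sum fact sits in its cone. The nesting RungFour → RungThree → RungTwo holds by
monotonicity of the bound
(planner's Sketch.lean).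

Rationale: WHY THIS LINE. The cut locus is the one spine of the homotopy 4-ball Σ ∖ B(p,ε) that comes with
analysis attached: for real-analytic g it
is a simplicial complex (Buchner1977Simplicial), for generic g in dimension ≤ 6 it is structurally
stable with a finite list
of local models — Maxwell strata A₁ᵏ (k ≤ 5 sheets meeting) glued to caustic strata
(Buchner1977Stability, Buchner1978;
codimension ≤ 3 structure for all metrics: AnguloGuijarro2011 Thm 2.2, Ozols1974, ItohTanaka2001,
Bishop1977) — and along a
path of metrics it changes only by finitely many embedded bifurcations, each intermediate cut locus
still a spine of the same
ball (metric-realised Matveev–Piergallini moves; spines ARE cut loci in dimension 3: Anisov2006,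
AlexanderBishop2000,
AlexanderBishop2003). Imported: Riemannian cut-locus theory and Lagrangian/Maxwell singularity
theory (the stratification and
the multiplicity N), PL topology (spines, a Matveev-type complexity c_cut = number of A₁⁵ vertices,
thickenings), classical
3-manifold input (Alexander1924 for the doubled 3-ball) and Cerf's Γ₄ = 0 (CerfDiffeoSphere1968) or,
Cerf-free, model
matching with the ellipsoid (ItohKiyohara2010). What it does that NoOneHandles / SchoenfliesSplit /
the shadow and trisection
complexities do not: the presentation is canonical up to (g,p), 3-dimensional, with a finite
local-model list and a numerical
grading N whose low rungs (N ≤ 2: no triple points; N ≤ 3: no quadruple curves) are unconditional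
statements about ALL
Riemannian homotopy 4-spheres, and whose top rung isolates exoticness in one combinatorial object: a
vertex-free simple
3-polyhedral spine. FreedmanNguyenPhan2021 (cut loci of almost negatively curved S⁴ as
non-separating immersed 3-spheres;
3-dimensional Bing houses in D⁴) and Weinstein1968 (conjugate-free cut loci on every closed
manifold) show the top of the
ladder is genuinely wild even on S⁴ — the ladder climbs from the ellipsoid end instead. No
probabilistic or spectral
reformulation is used; the negatives index is empty.

RANKED CRUXES. #2 MultiplicityFour (crux) — every homotopy 4-sphere Σ carries a smooth Riemannian
metric g and a point p such that (i) the metric cut locus Cut_g(p) is the homeomorphic image of (the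
space of) a finite simplicial complex and (ii) every point q is joined to p by at most four minimal
geodesics (midpoint count N(q) ≤ 4): the card's c_cut(Σ) = 0 — no quintuple (A₁⁵) points. Card items
r5/complexity ladder, ∃-half. [difficulty: open-problem] (why it might fail: c_cut may be a genuine
exotic invariant (like Matveev complexity in dim 3): no metric move is known that removes A₁⁵
vertices of the cut locus of a fake ball; only S⁴ (ellipsoids, N ≤ 2) is known to satisfy it.)
[Buchner1977Stability, Buchner1978, Buchner1977Simplicial, ItohKiyohara2010, Anisov2006,
Weinstein1968]
#3 RungFour (crux) — recognition at complexity zero: if a homotopy 4-sphere Σ carries a smooth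
Riemannian metric g and a point p whose cut locus is triangulable and whose minimal-geodesic
multiplicity is ≤ 4 everywhere (no quintuple points; generically: cleave sheets, triple surfaces,
quadruple curves and caustic strata only), then Σ ≅ S⁴. Card item r5 (c_cut = 0 ⇒ standard). [deps:
RungTwo, RungThree] [difficulty: open-problem] (why it might fail: no classification of vertex-free
simple 3-polyhedral spines of homotopy 4-balls exists (the dim-3 analogue rests on Matveev's
theory); degenerate caustic points with N ≤ 4 (A₃A₁³ transitions, D₄-type) must be handled too.)
[Buchner1978, AnguloGuijarro2011, FreedmanNguyenPhan2021, Matveev2000, CerfDiffeoSphere1968]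
#4 RungTwo (crux) — the bottom rung (no triple points): if a homotopy 4-sphere Σ carries a smooth
metric g and point p with triangulable cut locus and multiplicity ≤ 2 everywhere, then Σ ≅ S⁴.
Intended proof: the cut map S³ → Cut is ≤ 2-to-1, so Cut is a 3-manifold whose boundary is exactly
the edge set {N = 1} (covering argument), contractible with S² boundary; thin radial neighbourhoods
are tubular (transversality of the geodesic field at cleave points is automatic, fold normal form at
ribs), so Σ = B⁴ ∪ (C × I); ∂(C × I) = 2C ≅ S³ forces C ≅ B³ (Alexander1924), hence a twisted sphere
⇒ S⁴ (Cerf), or Cerf-free by matching radial data with the 4-ellipsoid model (ItohKiyohara2010 Thm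
7.1). [difficulty: L] (why it might fail: for non-generic g the conjugate rib {N=1} need not be of
fold (A₃) type: degenerate edges / degenerate cleave points (AnguloGuijarro2011 Thm 2.2) may make
'radial nbhd = tubular nbhd' as hard as a Schoenflies problem; may need a fold-rib hypothesis.)
[ItohKiyohara2010, AnguloGuijarro2011, Ozols1974, ItohTanaka2001, Alexander1924,
CerfDiffeoSphere1968]
#9 RungThree (support) — the middle rung (no quadruple curves): triangulable cut locus with
multiplicity ≤ 3 everywhere ⇒ Σ ≅ S⁴ (special case of RungFour, implies RungTwo; the new stratum is
the triple surface A₁³ with its caustic ends A₃A₁). [difficulty: XL] [Buchner1978,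
AnguloGuijarro2011]
#9 SphereMultiplicityTwo (support) — non-vacuity / model (known): the standard S⁴ carries a smooth
metric and a point whose cut locus is triangulable and has multiplicity ≤ 2 everywhere — the metric
of a 4-ellipsoid with distinct axes pulled back to S⁴, p off the codimension-2 set J₃: the cut locus
is a smoothly embedded closed 3-disc, interior points have exactly two minimal geodesics, boundary
points exactly one (ItohKiyohara2010 Thm 7.1 (1)–(2)); to be discharged from that theorem as a named
fact (cite item filed). [difficulty: provable-now] [ItohKiyohara2010, arXiv:0904.4743]
#9 PointCutLocusStandard (support) — the degenerate end of the dial (Cerf-free, builds the exp-map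
infrastructure every rung needs): if the metric cut locus of (g,p) on a homotopy 4-sphere is a
single point q₀, then Σ ≅ S⁴ — all geodesics from p are minimal up to distance d(p,q₀) and focus at
q₀, and polar coordinates from p and from q₀ assemble a diffeomorphism with the round sphere.
[difficulty: L] [Besse1987, Chavel2006, Weinstein1968]

TWO-LAYER PLAN. Foreseen glued splits (k ≤ 3, depth 1; nothing filed now). RungTwo ⇐ RibStructure
(tame + N ≤ 2 ⇒ Cut is a C¹ 3-manifold
whose boundary is the edge set {N=1}, of fold type off a null set) → RadialThickening (a thin radial
neighbourhood of Cut is a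
tubular neighbourhood, so Σ = B⁴ ∪ C × I and 2C ≅ S³) → RungTwo. RungFour ⇐ RungThree →
VertexFreeSpines (a homotopy 4-ball
with a simple 3-spine having no 5-fold points is B⁴) → RungFour. MultiplicityFour ⇐
SpineWithoutVertices (PL: every
homotopy 4-ball with S³ boundary has a simple 3-spine without A₁⁵ vertices, via 4-dimensional
Matveev–Piergallini moves) →
Realisation (Anisov one dimension up: simple 3-spines of Δ are cut loci of metrics on Δ ∪ B⁴) →
MultiplicityFour. The card's
headline CL line — CausticReach (a curvature/convexity condition forcing a conjugate free face on
every 3-cell) and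
MaxwellTwoSpine (collapsible Maxwell 2-spine ⇒ ball) — is an ALTERNATIVE decomposition of the same
target once
`IsCollapsible` / `conjugateLocus` definitions land (definition requests below): a sibling route
sharing these decls, not a
third layer here.

KILL CRITERIA. Every item is a consequence of SPC4, so a refutation of MultiplicityFour or of any
rung EXHIBITS an exotic 4-sphere: the
route closes `refuted:<Decl>` together with the problem. Structural kills of the LINE: (a) a
census/proof that the
degenerate-caustic case of RungTwo is equivalent to a Schoenflies-type statement — pivot by
`--restate RungTwo` with a
fold-rib hypothesis (tenure), not a close; (b) a proof that 'triangulable + N ≤ 4' places no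
restriction on the
2-handlebody type of Σ ∖ B (every contractible 4-dimensional 2-handlebody with S³ boundary carries
such a boundary cut
locus) — then RungFour = NoOneHandles' crux C2 verbatim and the route is closed `superseded --by
route-SmoothPoincare4-NoOneHandles`;
(c) SPC4 or 'every homotopy 4-sphere is a twisted sphere' proved elsewhere moots everything.

NOT DECOMPOSED YET. Rib regularity (fold normal form at edge points) and the exp-map infrastructure
the rungs need (Hopf–Rinow on compact
manifolds, injectivity of exp on the open cut domain, Lipschitz cut-time function ItohTanaka2001,
Klingenberg's lemma) —
layer-2 children of RungTwo; Buchner genericity as a hypothesis (needs `conjugateLocus`, definition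
request); the PL side
(`IsCollapsible`, regular neighbourhoods, 4-dimensional Matveev–Piergallini moves) — children of
MultiplicityFour; the
comparison-geometry crux CausticReach of the card (curvature ⇒ conjugate free faces; Myers1935 is
the 2-dimensional model)
and the Maxwell-2-spine crux — deferred to the sibling CL route; numerics of c_cut on explicit
metrics near Gluck /
Cappell–Shaneson presentations (kit) — deferred until an exp-map integrator exists in kit form.

CHEAPEST FALSIFIER. Two lookups a refuter can run first. (1) The covering step of RungTwo: from
AnguloGuijarro2011 Thm 2.2 (cleave / edge /
degenerate-cleave / crossing / remainder) and Bishop1977 (Cut = closure of {N ≥ 2}), check whether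
'triangulable + N ≤ 2'
really forces Cut(p) to be a topological 3-manifold with boundary {N = 1} — a counterexample ON S⁴
(a tame N ≤ 2 cut locus
that is not a manifold with boundary) does not refute RungTwo but kills its only proof plan and
forces the fold-rib
restatement at once. (2) Non-vacuity was checked this session: ItohKiyohara2010 (arXiv:0904.4743,
p.3 statement (1) and
Thm 7.1 p.18) gives on the 4-ellipsoid a smoothly embedded closed 3-disc cut locus with exactly two
minimal geodesics to
interior points and one to boundary points, so SphereMultiplicityTwo holds and no rung is vacuous. I
could not run a kit
experiment (no geodesic/cut-locus integrator in kit form).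

NUMBERS. Generic multiplicity bound in dimension n: N ≤ n + 1 = 5 (Maxwell strata A₁ᵏ, k ≤ 5;
Buchner1978, stable for n ≤ 6 by
Buchner1977Stability); rungs filed: N ≤ 2, 3, 4. Model: n-ellipsoid, p ∉ J_(n−1): Cut(p) = closed
(n−1)-disc, N = 2 inside,
1 on the boundary (ItohKiyohara2010 Thm 7.1); p ∈ J_(n−1): (n−2)-disc with S¹-families (N = ∞) —
excluded by every rung.
Weinstein1968: every closed manifold carries metrics with Cut(p) ∩ Conj(p) = ∅ (no edge points, no
free face: the top of the
ladder is occupied even on S⁴; FreedmanNguyenPhan2021 Thm 1: Bing houses Y³ ⊂ D⁴ exist). Items at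
open: 7 (3 cruxes,
3 support, 1 assembly).

DEFINITION REQUESTS. (1) `cutLocus g hg p : Set M` (topic Literature/Geometry/Riemannian; the metric
formula used inline above, with the lemma
that it is the classical cut locus for complete metrics, Bishop1977) and
`minimalGeodesicMultiplicity g hg p q : ℕ∞` (the
midpoint count). (2) `expMap` / `firstConjugateLocus` for a Riemannian `PseudoRiemannianMetric`
(same topic) — to state
Buchner genericity and the card's CausticReach. (3) `IsCollapsible` for finite simplicial complexes
and smooth regular
neighbourhoods of smoothly triangulated compact subsets (topic Literature/Topology/FourManifolds,
over PLManifold.lean) — to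
state the card's CL thesis 'collapsible cut locus ⇒ S⁴'. Cite facts wanted: ItohKiyohara2010 Thm 7.1
(discharges
SphereMultiplicityTwo); Buchner1977Simplicial main theorem; Bishop1977 main theorem; Weinstein1968
main theorem.

Novelty: Searches (2026-08-15): `lit search --source zbmath` for "cut locus ellipsoid Itoh Kiyohara" (4),
"Itoh Kiyohara cut loci
ellipsoids Liouville" (1: doi:10.4310/ajm.2010.v14.n2.a6, read pp.3,18), "Buchner simplicial
structure real analytic cut
locus" (1), "cut locus spine" (5: Anisov2006, AlexanderBishop2000/2003, Anisov CRAS 2006), "cut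
locus triangulable" (4:
Buchner1977Simplicial, Singer–Gluck 1976, Hebda 1995, AnguloGuijarro2011 — read Thm 2.2), "cut locus
sphere theorem" (8:
Warner 1967 conjugate loci of constant order, Gluck–Warner–Ziller, none on multiplicity), "cut locus
structure dimension six"
(2: Buchner1978), "Weinstein cut locus conjugate locus" (2: Weinstein1968, FreedmanNguyenPhan2021 —
read §1: cut loci in
S⁴, Bing houses), "Omori class of Riemannian metrics cut locus" (1: Omori 1968), "cut locus homotopy
sphere exotic" (0),
"cut locus order two points" (0), "number of minimal geodesics cut locus topology" (0); `lit search
--source crossref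
"cut locus spine homotopy ball collapsible"` (10, noise); `lit galaxy search "cut locus exotic
sphere" --star pdf` (0),
`"two minimal geodesics cut locus sphere" --star panama` (0), `--star all` twice (queue timeout);
`lit frontier
SmoothPoincare4 --since 2020` (30 rows, no cut-locus item), `lit bridges SmoothPoincare4 --cross
any`; `lean search` for
cutLocus / expMap / Collapsible (none in tree); OpenAlex and arXiv APIs rate-limited (429) this
session; plus the card's and
the novelty auditor's searches (zbMATH 'cut locus spi  [refs: 10.4310/ajm.2010.v14.n2.a6, doi:10.4310/ajm.2010.v14.n2.a6]

Barriers (technique_class: cut-locus, geodesic-multiplicity, pl-spines): - technique_class: cut-locus, geodesic-multiplicity, pl-spines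
- Literature.Barriers.SmoothPoincare4.PropertyTwoRBarrier: applies only to an attack on
RungFour/MultiplicityFour by Andrews–Curtis-type moves on a 2-dimensional spine; the ladder works
with 3-dimensional cut loci and metric-realised bifurcations (A₁⁵ vertices die at A₃A₁³
transitions), which re-inflate and collapse 3-cells and are not AC moves — an honest bet, no evasion
theorem.
- Literature.Barriers.SmoothPoincare4.StrictPropertyTwoRBarrier: same status as PropertyTwoRBarrier
(bites only if a prover reduces a rung to handle slides of a 2-handlebody presentation).
- Literature.Barriers.SmoothPoincare4.TwistedSphereBarrierFour: used positively only — rungs end in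
Σ = B⁴ ∪ (B³ × I) ⇒ S⁴ via Γ₄ = 0, or Cerf-free by ellipsoid model matching; nothing exotic is
sought among twisted spheres.
- Literature.Barriers.SmoothPoincare4.OpenAnalogueBarrierFour: respected — Σ ∖ Cut_g(p) ≅ ℝ⁴ holds
for EVERY Σ (radial structure), so the line never infers standardness from an open ball or from Σ ∖
{p}; recognition goes through the closed thickening of the spine.
- Literature.Barriers.SmoothPoincare4.HCobordismBarrierFour: not invoked (no h-cobordism; the
diffeomorphism is assembled from radial and tubular coordinates).
- Literature.Barriers.SmoothPoincare4.ContractibleBarrierFour: consistent — no claim that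
homeomorphic contractible 4-manifolds are diffeomorphic; Δ = Σ ∖ B is recognised only under the
explicit spine hypotheses of

History (route lifecycle, newest last):
- 2026-08-15T16:52:46Z · rev 2: restated MultiplicityFour (stmt-SmoothPoincare4-6835), RungFour (stmt-SmoothPoincare4-6836), RungTwo (stmt-SmoothPoincare4-6837), RungThree (stmt-SmoothPoincare4-6838), PointCutLocusStandard (stmt-SmoothPoincare4-6840) — route-repair (cone): the import cone carried 16 unproved named facts (h-cobordism theorem n> (planner-rrepair-SmoothPoincare4-CutLocusSpine-493d4bde-0)
- 2026-08-22T10:35:41Z · DORMANT — reconciler: no traction for 5.3 d (last activity item-evidence-added at 2026-08-17T03:14:47Z); parked, not closed — `ledger route dormant route-SmoothPoincare4- (operator:999:4003570)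

sub-problem: SmoothPoincare4 · status: dormant · opened planner-plancard-SmoothPoincare4-SmoothPoinca-d2b704f0-0 2026-08-15T11:54:04Z · rev 2 · ledger route-SmoothPoincare4-CutLocusSpine
GENERATED by the gate from the ledger (D-0016/17). Provers cite these decls: `theorem foo : Summit.SmoothPoincare4.SmoothPoincare4.Theses.CutLocusSpine.<Decl> := …` in Summits/SmoothPoincare4/SmoothPoincare4/Theorems/<Name>.lean.
-/

namespace Summit.SmoothPoincare4.SmoothPoincare4.Theses.CutLocusSpine

open scoped BigOperators Topology Manifold Classical MeasureTheory ProbabilityTheory Matrix InnerProductSpace ComplexConjugate ContinuousMap ContDiff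
open Filter Set Function TopologicalSpace MeasureTheory

attribute [summit_statement] _root_.SmoothPoincare4

open Literature.SPC4

-- earlier MultiplicityFour (stmt-SmoothPoincare4-6835, replaced 2026-08-15T16:52:46Z -> stmt-SmoothPoincare4-11118): retired by None — ∀ S : Literature.Topology.FourManifolds.HomotopySphere 4, ∃ (g : Literature.Geometry.Lorentzian.PseudoRiemannianMetric (𝓡 4) ∞ (EuclideanSpace ℝ (Fin 4)) (TangentSpace (𝓡 4) : S.carrier → Type _)) (hg : g.IsRiemannian) (p : S.carrier), (∃ (k : ℕ) (K : Geometry.Simpli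
/-- item stmt-SmoothPoincare4-11118 · crux · rank 2 · open · by planner
why it might fail: c_cut may be a genuine exotic invariant (like Matveev complexity in dim 3): no metric move is known that removes A₁⁵ vertices of the cut locus of a fake ball; only S⁴ (ellipsoids, N ≤ 2) is known to satisfy it.
sources: Buchner1977Stability, Buchner1978, Buchner1977Simplicial, ItohKiyohara2010, Anisov2006, Weinstein1968
[crux] every homotopy 4-sphere — a Hausdorff second-countable smooth 4-manifold M with a homotopy
equivalence e : M ≃ₕ S⁴, exactly the binders of `SmoothPoincare4` (M is then compact and orientable
by the PROVED facts compactSpace_of_homotopyEquiv_sphere_four_holds /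
isOrientable_of_homotopyEquiv_sphere_four_holds, which provers may invoke; neither is a hypothesis,
so the route imports no homotopy-sphere / h-cobordism module) — carries a smooth Riemannian metric g
and a point p such that (i) the metric cut locus Cut_g(p) = {q ≠ p | no r ≠ q with d(p,r) = d(p,q) +
d(q,r)} is the homeomorphic image of (the space of) a finite simplicial complex and (ii) every point
q is joined to p by at most four minimal geodesics (midpoint count N(q) ≤ 4): the card's c_cut = 0 —
no quintuple (A₁⁵) points. Card items r5/complexity ladder, ∃-half. Rev 2 (cone repair): same claim
as rev 1, restated from the bundled `HomotopySphere 4` to the bare (M, e) form. [difficulty: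
open-problem] -/
@[route_item "route-SmoothPoincare4-CutLocusSpine", crux]
def MultiplicityFour : Prop :=
  ∀ (M : Type) [TopologicalSpace M] [T2Space M] [SecondCountableTopology M] [ChartedSpace (EuclideanSpace ℝ (Fin 4)) M] [IsManifold (𝓡 4) ∞ M], ContinuousMap.HomotopyEquiv M (Metric.sphere (0 : EuclideanSpace ℝ (Fin 5)) 1) → ∃ (g : Literature.Geometry.Lorentzian.PseudoRiemannianMetric (𝓡 4) ∞ (EuclideanSpace ℝ (Fin 4)) (TangentSpace (𝓡 4) : M → Type _)) (hg : g.IsRiemannian) (p : M), (∃ (k : ℕ) (K : Geometry.SimplicialComplex ℝ (EuclideanSpace ℝ (Fin k))) (φ : K.space → M), K.faces.Finite ∧ Topology.IsEmbedding φ ∧ Set.range φ = {q : M | q ≠ p ∧ ∀ r : M, g.edist hg p r = g.edist hg p q + g.edist hg q r → r = q}) ∧ ∀ q : M, ({m : M | g.edist hg p m = g.edist hg m q ∧ g.edist hg p m + g.edist hg m q = g.edist hg p q}).encard ≤ 4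

-- earlier RungFour (stmt-SmoothPoincare4-6836, replaced 2026-08-15T16:52:46Z -> stmt-SmoothPoincare4-11119): retired by None — ∀ (S : Literature.Topology.FourManifolds.HomotopySphere 4) (g : Literature.Geometry.Lorentzian.PseudoRiemannianMetric (𝓡 4) ∞ (EuclideanSpace ℝ (Fin 4)) (TangentSpace (𝓡 4) : S.carrier → Type _)) (hg : g.IsRiemannian) (p : S.carrier), (∃ (k : ℕ) (K : Geometry.SimplicialCompl
/-- item stmt-SmoothPoincare4-11119 · crux · rank 3 · open · by planner
why it might fail: no classification of vertex-free simple 3-polyhedral spines of homotopy 4-balls exists (the dim-3 analogue rests on Matveev's theory); degenerate caustic points with N ≤ 4 (A₃A₁³ transitions, D₄-type) must be handled too.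
sources: Buchner1978, AnguloGuijarro2011, FreedmanNguyenPhan2021, Matveev2000, CerfDiffeoSphere1968
[crux] recognition at complexity zero: if a homotopy 4-sphere (M, e : M ≃ₕ S⁴, binders of the
Statement) carries a smooth Riemannian metric g and a point p whose metric cut locus is triangulable
and whose minimal-geodesic multiplicity is ≤ 4 everywhere (no quintuple points; generically: cleave
sheets, triple surfaces, quadruple curves and caustic strata only), then M ≅ S⁴. Card item r5 (c_cut
= 0 ⇒ standard). Implies RungThree and RungTwo by monotonicity of the bound (Sketch.lean). Rev 2
(cone repair): bare (M, e) form, compactness derivable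
(compactSpace_of_homotopyEquiv_sphere_four_holds), not assumed. [deps: RungTwo, RungThree]
[difficulty: open-problem] -/
@[route_item "route-SmoothPoincare4-CutLocusSpine", crux]
def RungFour : Prop :=
  ∀ (M : Type) [TopologicalSpace M] [T2Space M] [SecondCountableTopology M] [ChartedSpace (EuclideanSpace ℝ (Fin 4)) M] [IsManifold (𝓡 4) ∞ M], ContinuousMap.HomotopyEquiv M (Metric.sphere (0 : EuclideanSpace ℝ (Fin 5)) 1) → ∀ (g : Literature.Geometry.Lorentzian.PseudoRiemannianMetric (𝓡 4) ∞ (EuclideanSpace ℝ (Fin 4)) (TangentSpace (𝓡 4) : M → Type _)) (hg : g.IsRiemannian) (p : M), (∃ (k : ℕ) (K : Geometry.SimplicialComplex ℝ (EuclideanSpace ℝ (Fin k))) (φ : K.space → M), K.faces.Finite ∧ Topology.IsEmbedding φ ∧ Set.range φ = {q : M | q ≠ p ∧ ∀ r : M, g.edist hg p r = g.edist hg p q + g.edist hg q r → r = q}) → (∀ q : M, ({m : M | g.edist hg p m = g.edist hg m q ∧ g.edist hg p m + g.edist hg m q = g.edist hg p q}).encard ≤ 4) → Nonempty (M ≃ₘ⟮𝓡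 4, 𝓡 4⟯ Metric.sphere (0 : EuclideanSpace ℝ (Fin 5)) 1)

-- earlier RungTwo (stmt-SmoothPoincare4-6837, replaced 2026-08-15T16:52:46Z -> stmt-SmoothPoincare4-11120): retired by None — ∀ (S : Literature.Topology.FourManifolds.HomotopySphere 4) (g : Literature.Geometry.Lorentzian.PseudoRiemannianMetric (𝓡 4) ∞ (EuclideanSpace ℝ (Fin 4)) (TangentSpace (𝓡 4) : S.carrier → Type _)) (hg : g.IsRiemannian) (p : S.carrier), (∃ (k : ℕ) (K : Geometry.SimplicialComple
/-- item stmt-SmoothPoincare4-11120 · crux · rank 4 · open · by planner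
why it might fail: for non-generic g the conjugate rib {N=1} need not be of fold (A₃) type: degenerate edges / degenerate cleave points (AnguloGuijarro2011 Thm 2.2) may make 'radial nbhd = tubular nbhd' as hard as a Schoenflies problem; may need a fold-rib hypothesis.
sources: ItohKiyohara2010, AnguloGuijarro2011, Ozols1974, ItohTanaka2001, Alexander1924, CerfDiffeoSphere1968
[crux] the bottom rung (no triple points): if a homotopy 4-sphere (M, e : M ≃ₕ S⁴) carries a smooth
Riemannian metric g and a point p with triangulable metric cut locus and multiplicity ≤ 2
everywhere, then M ≅ S⁴. Intended proof: M is compact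
(compactSpace_of_homotopyEquiv_sphere_four_holds), so g is complete; the cut map S³ → Cut is ≤
2-to-1, so Cut is a 3-manifold whose boundary is exactly the edge set {N = 1} (covering argument),
contractible with S² boundary; thin radial neighbourhoods are tubular (transversality of the
geodesic field at cleave points is automatic, fold normal form at ribs), so M = B⁴ ∪ (C × I); ∂(C ×
I) = 2C ≅ S³ forces C ≅ B³ (Alexander1924), hence a twisted sphere ⇒ S⁴ (Cerf), or Cerf-free by
matching radial data with the 4-ellipsoid model (ItohKiyohara2010 Thm 7.1). Rev 2 (cone repair):
bare (M, e) form. [difficulty: L] -/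
@[route_item "route-SmoothPoincare4-CutLocusSpine"]
def RungTwo : Prop :=
  ∀ (M : Type) [TopologicalSpace M] [T2Space M] [SecondCountableTopology M] [ChartedSpace (EuclideanSpace ℝ (Fin 4)) M] [IsManifold (𝓡 4) ∞ M], ContinuousMap.HomotopyEquiv M (Metric.sphere (0 : EuclideanSpace ℝ (Fin 5)) 1) → ∀ (g : Literature.Geometry.Lorentzian.PseudoRiemannianMetric (𝓡 4) ∞ (EuclideanSpace ℝ (Fin 4)) (TangentSpace (𝓡 4) : M → Type _)) (hg : g.IsRiemannian) (p : M), (∃ (k : ℕ) (K : Geometry.SimplicialComplex ℝ (EuclideanSpace ℝ (Fin k))) (φ : K.space → M), K.faces.Finite ∧ Topology.IsEmbedding φ ∧ Set.range φ = {q : M | q ≠ p ∧ ∀ r : M, g.edist hg p r = g.edist hg p q + g.edist hg q r → r = q}) → (∀ q : M, ({m : M | g.edist hg p m = g.edist hg m q ∧ g.edist hg p m + g.edist hg m q = g.edist hg p q}).encard ≤ 2) → Nonempty (M ≃ₘ⟮𝓡 4, 𝓡 4⟯ Metric.sphere (0 : EuclideanSpace ℝ (Fin 5)) 1)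

-- earlier RungThree (stmt-SmoothPoincare4-6838, replaced 2026-08-15T16:52:46Z -> stmt-SmoothPoincare4-11121): retired by None — ∀ (S : Literature.Topology.FourManifolds.HomotopySphere 4) (g : Literature.Geometry.Lorentzian.PseudoRiemannianMetric (𝓡 4) ∞ (EuclideanSpace ℝ (Fin 4)) (TangentSpace (𝓡 4) : S.carrier → Type _)) (hg : g.IsRiemannian) (p : S.carrier), (∃ (k : ℕ) (K : Geometry.SimplicialComp
/-- item stmt-SmoothPoincare4-11121 · support · rank 9 · open · by planner
sources: Buchner1978, AnguloGuijarro2011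
[support] the middle rung (no quadruple curves): a homotopy 4-sphere (M, e : M ≃ₕ S⁴) with a smooth
Riemannian metric whose metric cut locus from some point is triangulable with multiplicity ≤ 3
everywhere is diffeomorphic to S⁴ (special case of RungFour, implies RungTwo; the new stratum is the
triple surface A₁³ with its caustic ends A₃A₁). Rev 2 (cone repair): bare (M, e) form. [difficulty:
XL] -/
@[route_item "route-SmoothPoincare4-CutLocusSpine"]
def RungThree : Prop :=
  ∀ (M : Type) [TopologicalSpace M] [T2Space M] [SecondCountableTopology M] [ChartedSpace (EuclideanSpace ℝ (Fin 4)) M] [IsManifold (𝓡 4) ∞ M], ContinuousMap.HomotopyEquiv M (Metric.sphere (0 : EuclideanSpace ℝ (Fin 5)) 1) → ∀ (g : Literature.Geometry.Lorentzian.PseudoRiemannianMetric (𝓡 4) ∞ (EuclideanSpace ℝ (Fin 4)) (TangentSpace (𝓡 4) : M → Type _)) (hg : g.IsRiemannian) (p : M), (∃ (k : ℕ) (K : Geometry.SimplicialComplex ℝ (EuclideanSpace ℝ (Fin k))) (φ : K.space → M), K.faces.Finite ∧ Topology.IsEmbedding φ ∧ Set.range φ = {q : M | q ≠ p ∧ ∀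 r : M, g.edist hg p r = g.edist hg p q + g.edist hg q r → r = q}) → (∀ q : M, ({m : M | g.edist hg p m = g.edist hg m q ∧ g.edist hg p m + g.edist hg m q = g.edist hg p q}).encard ≤ 3) → Nonempty (M ≃ₘ⟮𝓡 4, 𝓡 4⟯ Metric.sphere (0 : EuclideanSpace ℝ (Fin 5)) 1)

-- earlier PointCutLocusStandard (stmt-SmoothPoincare4-6840, replaced 2026-08-15T16:52:46Z -> stmt-SmoothPoincare4-11122): retired by None — ∀ (S : Literature.Topology.FourManifolds.HomotopySphere 4) (g : Literature.Geometry.Lorentzian.PseudoRiemannianMetric (𝓡 4) ∞ (EuclideanSpace ℝ (Fin 4)) (TangentSpace (𝓡 4) : S.carrier → Type _)) (hg : g.IsRiemannian) (p q₀ : S.carrier), {q : S.carrier | q ≠ p ∧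
/-- item stmt-SmoothPoincare4-11122 · support · rank 9 · open · by planner
sources: Besse1987, Chavel2006, Weinstein1968
[support] the degenerate end of the dial (Cerf-free, builds the exp-map infrastructure every rung
needs): if on a homotopy 4-sphere (M, e : M ≃ₕ S⁴) the metric cut locus of (g, p) is a single point
q₀, then M ≅ S⁴ — M is compact (compactSpace_of_homotopyEquiv_sphere_four_holds) so g is complete,
all geodesics from p are minimal up to distance d(p,q₀) and focus at q₀, and polar coordinates from
p and from q₀ assemble a diffeomorphism with the round sphere. Rev 2 (cone repair): bare (M, e)
form. [difficulty: L] -/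
@[route_item "route-SmoothPoincare4-CutLocusSpine"]
def PointCutLocusStandard : Prop :=
  ∀ (M : Type) [TopologicalSpace M] [T2Space M] [SecondCountableTopology M] [ChartedSpace (EuclideanSpace ℝ (Fin 4)) M] [IsManifold (𝓡 4) ∞ M], ContinuousMap.HomotopyEquiv M (Metric.sphere (0 : EuclideanSpace ℝ (Fin 5)) 1) → ∀ (g : Literature.Geometry.Lorentzian.PseudoRiemannianMetric (𝓡 4) ∞ (EuclideanSpace ℝ (Fin 4)) (TangentSpace (𝓡 4) : M → Type _)) (hg : g.IsRiemannian) (p q₀ : M), {q : M | q ≠ p ∧ ∀ r : M, g.edist hg p r = g.edist hg p q + g.edist hg q r → r = q} = {q₀} → Nonempty (M ≃ₘ⟮𝓡 4, 𝓡 4⟯ Metric.sphere (0 : EuclideanSpace ℝ (Fin 5)) 1)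

/-- item stmt-SmoothPoincare4-6839 · support · rank 9 · open · by planner
sources: ItohKiyohara2010, arXiv:0904.4743
[support] non-vacuity / model (known): the standard S⁴ carries a smooth metric and a point whose cut
locus is triangulable and has multiplicity ≤ 2 everywhere — the metric of a 4-ellipsoid with
distinct axes pulled back to S⁴, p off the codimension-2 set J₃: the cut locus is a smoothly
embedded closed 3-disc, interior points have exactly two minimal geodesics, boundary points exactly
one (ItohKiyohara2010 Thm 7.1 (1)–(2)); to be discharged from that theorem as a named fact (cite
item filed). [difficulty: provable-now] -/
@[route_item "route-SmoothPoincare4-CutLocusSpine"]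
def SphereMultiplicityTwo : Prop :=
  ∃ (g : Literature.Geometry.Lorentzian.PseudoRiemannianMetric (𝓡 4) ∞ (EuclideanSpace ℝ (Fin 4)) (TangentSpace (𝓡 4) : (Metric.sphere (0 : EuclideanSpace ℝ (Fin 5)) 1) → Type _)) (hg : g.IsRiemannian) (p : (Metric.sphere (0 : EuclideanSpace ℝ (Fin 5)) 1)), (∃ (k : ℕ) (K : Geometry.SimplicialComplex ℝ (EuclideanSpace ℝ (Fin k))) (φ : K.space → (Metric.sphere (0 : EuclideanSpace ℝ (Fin 5)) 1)), K.faces.Finite ∧ Topology.IsEmbedding φ ∧ Set.range φ = {q : (Metric.sphere (0 : EuclideanSpace ℝ (Fin 5)) 1) | q ≠ p ∧ ∀ r : (Metric.sphere (0 : EuclideanSpace ℝ (Fin 5)) 1), g.edist hg p r = g.edist hg p q + g.edist hg q r → r = q}) ∧ ∀ q : (Metric.sphere (0 : EuclideanSpace ℝ (Fin 5)) 1), ({m : (Metric.sphere (0 : EuclideanSpace ℝ (Fin 5)) 1) | g.edist hg p m = g.edist hg m q ∧ g.edist hg p m + g.edist hg m q = g.edist hg p q}).encard ≤ 2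

/-- item stmt-SmoothPoincare4-6841 · assembly · rank 1 · open · by planner
sources: KervaireMilnor1963, ItohKiyohara2010
[assembly] MultiplicityFour → RungFour → SmoothPoincare4. -/
@[route_item "route-SmoothPoincare4-CutLocusSpine"]
def Assembly : Prop :=
  MultiplicityFour → RungFour → SmoothPoincare4

/-! D-0027 §2.1 — DECIDING THEOREM (planner-authored via `route open/edit --closes-file`; by planner-rrepair-SmoothPoincare4-CutLocusSpine-493d4bde-0 2026-08-15T16:52:46Z):
its hypotheses are this route's items and its conclusion the sub-problem Statement (glue_lint), and it elaborates with this file. -/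

@[closes "route-SmoothPoincare4-CutLocusSpine"] theorem closes (hM : MultiplicityFour) (hR : RungFour) : _root_.SmoothPoincare4 := by
  intro M _ _ _ _ _ e
  obtain ⟨g, hg, p, hT, hN⟩ := hM M e
  exact hR M e g hg p hT hN

end Summit.SmoothPoincare4.SmoothPoincare4.Theses.CutLocusSpine
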